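import Summits.Ventures.Crystal3D.Theorems.StickyWulffConstantNoReconstructionGainPredSlotBudgetRaisedLanded
import HarnessLib

/-!
# The pred-slot budget with a LEVEL third up bond: the landed cap budget

HONEST FRAMING. Part of the venture `Summits/Ventures/Crystal3D` (cell `crystal3d-full`), helper
`--supports` the crux `NoReconstructionGain` (stmt-Ventures-19144, route
`route-Ventures-StickyWulffConstant`), line `adhesion` (wulff-p1 g15).  Companion of
`…PredSlotBudgetRaisedLanded` for the level case `⟪A w₃, ν⟫ = 0` of B1b₃
(`predSlotBudget_of_upBond_raised_three`): the landed cap budget bounds `#K` by the pred-slot credits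
plus `½` per level hex pair plus `½[A w₃ blocked] + ½[−A w₃ blocked]` (`pair_level`,
`predSlotBudget_coreR_landed_level`).

WHAT THIS IS NOT: the brick B1b₃ itself; rung F-C1 not moved.
-/

noncomputable section

namespace Summit.Ventures.Crystal3D.Theorems

open Summit.Ventures.Crystal3D Finset
open Literature.MathematicalPhysics.StatisticalMechanics (fccStacking barlowPos constHagg barlowPos_mem
  threeOffsets barlowPos_apply_zero barlowPos_apply_one barlowPos_apply_two haggLabel_const)
open scoped InnerProductSpace

/-- **Level pair.**  For an antipodal pair `±v` with `⟪v, ν⟫ = 0`, the landed credits are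
`½[v blocked] + ½[−v blocked]`. -/
theorem pair_level (v ν : EuclideanSpace ℝ (Fin 3)) (K : Finset (EuclideanSpace ℝ (Fin 3))) (t : ℝ)
    (hv : ⟪v, ν⟫_ℝ = 0) :
    ((if ⟪v, ν⟫_ℝ < 0 ∧ ((∃ u ∈ K, 1 / 2 < ⟪u, v⟫_ℝ) ∨ ⟪v, ν⟫_ℝ ≤ -t) then (1 : ℝ) else 0) +
        1 / 2 * (if ⟪v, ν⟫_ℝ = 0 ∧ (∃ u ∈ K, 1 / 2 < ⟪u, v⟫_ℝ) then (1 : ℝ) else 0)) +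
      ((if ⟪-v, ν⟫_ℝ < 0 ∧ ((∃ u ∈ K, 1 / 2 < ⟪u, -v⟫_ℝ) ∨ ⟪-v, ν⟫_ℝ ≤ -t) then (1 : ℝ) else 0) +
        1 / 2 * (if ⟪-v, ν⟫_ℝ = 0 ∧ (∃ u ∈ K, 1 / 2 < ⟪u, -v⟫_ℝ) then (1 : ℝ) else 0)) =
      1 / 2 * (if (∃ u ∈ K, 1 / 2 < ⟪u, v⟫_ℝ) then (1 : ℝ) else 0) +
        1 / 2 * (if (∃ u ∈ K, 1 / 2 < ⟪u, -v⟫_ℝ) then (1 : ℝ) else 0) := by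
  have h4 : ⟪-v, ν⟫_ℝ = 0 := by rw [inner_neg_left, hv, neg_zero]
  simp only [hv, h4, lt_self_iff_false, false_and, if_false, true_and, zero_add]

/-- **The landed cap budget in a frame with LEVEL `w₃`.**  If `⟪A w₃, ν⟫ = 0` and `A w₁`, `A w₂` are
strictly `ν`-below, then for hex representatives `g_j = ±A h_j`:
`#K ≤ Σ_j (cred(lower g_j) + ½ [⟪A h_j, ν⟫ = 0]) + cred(A w₁) + cred(A w₂) + ½[A w₃ blocked] + ½[−A w₃ blocked]`. -/
theorem predSlotBudget_coreR_landed_level (A : EuclideanSpace ℝ (Fin 3) ≃ₗᵢ[ℝ] EuclideanSpace ℝ (Fin 3))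
    (ν : EuclideanSpace ℝ (Fin 3)) (hν : ‖ν‖ = 1) (t : ℝ) (ht : 0 < t)
    (K : Finset (EuclideanSpace ℝ (Fin 3))) (hK : K.card ≤ 3)
    (hK1 : ∀ u ∈ K, ‖u‖ = 1 ∧ ⟪u, ν⟫_ℝ ≤ -t) (hK2 : ∀ u ∈ K, ∀ u' ∈ K, u ≠ u' → ⟪u, u'⟫_ℝ ≤ 1 / 2)
    (g₁ g₂ g₃ : EuclideanSpace ℝ (Fin 3))
    (hg₁ : g₁ = A (barlowPos 1 (Real.sqrt (2 / 3)) constHagg 0 1 0) ∨ g₁ = -A (barlowPos 1 (Real.sqrt (2 / 3)) constHagg 0 1 0))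
    (hg₂ : g₂ = A (barlowPos 1 (Real.sqrt (2 / 3)) constHagg 0 0 1) ∨ g₂ = -A (barlowPos 1 (Real.sqrt (2 / 3)) constHagg 0 0 1))
    (hg₃ : g₃ = A (barlowPos 1 (Real.sqrt (2 / 3)) constHagg 0 1 (-1)) ∨ g₃ = -A (barlowPos 1 (Real.sqrt (2 / 3)) constHagg 0 1 (-1)))
    (hw₁ : ⟪A (barlowPos 1 (Real.sqrt (2 / 3)) constHagg 1 0 0), ν⟫_ℝ < 0) (hw₂ : ⟪A (barlowPos 1 (Real.sqrt (2 / 3)) constHagg 1 (-1) 0), ν⟫_ℝ < 0)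
    (hw₃ : ⟪A (barlowPos 1 (Real.sqrt (2 / 3)) constHagg 1 0 (-1)), ν⟫_ℝ = 0) :
    (K.card : ℝ) ≤
      (if (∃ u ∈ K, 1 / 2 < ⟪u, if ⟪g₁, ν⟫_ℝ < 0 then g₁ else -g₁⟫_ℝ) ∨
          ⟪(if ⟪g₁, ν⟫_ℝ < 0 then g₁ else -g₁), ν⟫_ℝ ≤ -t then (1 : ℝ) else 0) + 1 / 2 * (if ⟪A (barlowPos 1 (Real.sqrt (2 / 3)) constHagg 0 1 0), ν⟫_ℝ = 0 then (1 : ℝ) else 0) +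
      ((if (∃ u ∈ K, 1 / 2 < ⟪u, if ⟪g₂, ν⟫_ℝ < 0 then g₂ else -g₂⟫_ℝ) ∨
          ⟪(if ⟪g₂, ν⟫_ℝ < 0 then g₂ else -g₂), ν⟫_ℝ ≤ -t then (1 : ℝ) else 0) + 1 / 2 * (if ⟪A (barlowPos 1 (Real.sqrt (2 / 3)) constHagg 0 0 1), ν⟫_ℝ = 0 then (1 : ℝ) else 0)) +
      ((if (∃ u ∈ K, 1 / 2 < ⟪u, if ⟪g₃, ν⟫_ℝ < 0 then g₃ else -g₃⟫_ℝ) ∨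
          ⟪(if ⟪g₃, ν⟫_ℝ < 0 then g₃ else -g₃), ν⟫_ℝ ≤ -t then (1 : ℝ) else 0) + 1 / 2 * (if ⟪A (barlowPos 1 (Real.sqrt (2 / 3)) constHagg 0 1 (-1)), ν⟫_ℝ = 0 then (1 : ℝ) else 0)) +
      (if (∃ u ∈ K, 1 / 2 < ⟪u, A (barlowPos 1 (Real.sqrt (2 / 3)) constHagg 1 0 0)⟫_ℝ) ∨ ⟪A (barlowPos 1 (Real.sqrt (2 / 3)) constHagg 1 0 0), ν⟫_ℝ ≤ -t then (1 : ℝ) else 0) +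
      (if (∃ u ∈ K, 1 / 2 < ⟪u, A (barlowPos 1 (Real.sqrt (2 / 3)) constHagg 1 (-1) 0)⟫_ℝ) ∨ ⟪A (barlowPos 1 (Real.sqrt (2 / 3)) constHagg 1 (-1) 0), ν⟫_ℝ ≤ -t then (1 : ℝ) else 0) +
      (1 / 2 * (if (∃ u ∈ K, 1 / 2 < ⟪u, A (barlowPos 1 (Real.sqrt (2 / 3)) constHagg 1 0 (-1))⟫_ℝ) then (1 : ℝ) else 0) +
        1 / 2 * (if (∃ u ∈ K, 1 / 2 < ⟪u, -A (barlowPos 1 (Real.sqrt (2 / 3)) constHagg 1 0 (-1))⟫_ℝ) then (1 : ℝ) else 0)) := by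
  obtain ⟨ew₂, ew₃⟩ := upBonds_eq_neg
  have h12 := frameCapBudget_sum_le A ν hν t ht K hK hK1 hK2
  rw [ew₂, ew₃] at h12
  simp only [List.map_cons, List.map_nil, List.sum_cons, List.sum_nil, add_zero, map_neg, neg_neg] at h12
  have P1 : ((if ⟪A (barlowPos 1 (Real.sqrt (2 / 3)) constHagg 0 1 0), ν⟫_ℝ < 0 ∧ ((∃ u ∈ K, 1 / 2 < ⟪u, A (barlowPos 1 (Real.sqrt (2 / 3)) constHagg 0 1 0)⟫_ℝ) ∨ ⟪A (barlowPos 1 (Real.sqrt (2 / 3)) constHagg 0 1 0), ν⟫_ℝ ≤ -t) then (1 : ℝ) else 0) +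
        1 / 2 * (if ⟪A (barlowPos 1 (Real.sqrt (2 / 3)) constHagg 0 1 0), ν⟫_ℝ = 0 ∧ (∃ u ∈ K, 1 / 2 < ⟪u, A (barlowPos 1 (Real.sqrt (2 / 3)) constHagg 0 1 0)⟫_ℝ) then (1 : ℝ) else 0)) +
      ((if ⟪-A (barlowPos 1 (Real.sqrt (2 / 3)) constHagg 0 1 0), ν⟫_ℝ < 0 ∧ ((∃ u ∈ K, 1 / 2 < ⟪u, -A (barlowPos 1 (Real.sqrt (2 / 3)) constHagg 0 1 0)⟫_ℝ) ∨ ⟪-A (barlowPos 1 (Real.sqrt (2 / 3)) constHagg 0 1 0), ν⟫_ℝ ≤ -t) then (1 : ℝ) else 0) +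
        1 / 2 * (if ⟪-A (barlowPos 1 (Real.sqrt (2 / 3)) constHagg 0 1 0), ν⟫_ℝ = 0 ∧ (∃ u ∈ K, 1 / 2 < ⟪u, -A (barlowPos 1 (Real.sqrt (2 / 3)) constHagg 0 1 0)⟫_ℝ) then (1 : ℝ) else 0)) ≤
      (if (∃ u ∈ K, 1 / 2 < ⟪u, if ⟪g₁, ν⟫_ℝ < 0 then g₁ else -g₁⟫_ℝ) ∨
          ⟪(if ⟪g₁, ν⟫_ℝ < 0 then g₁ else -g₁), ν⟫_ℝ ≤ -t then (1 : ℝ) else 0) +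
        1 / 2 * (if ⟪A (barlowPos 1 (Real.sqrt (2 / 3)) constHagg 0 1 0), ν⟫_ℝ = 0 then (1 : ℝ) else 0) := by
    rcases hg₁ with rfl | rfl
    · exact pair_hex_le _ ν K t
    · exact pair_hex_le' _ ν K t
  have P2 : ((if ⟪A (barlowPos 1 (Real.sqrt (2 / 3)) constHagg 0 0 1), ν⟫_ℝ < 0 ∧ ((∃ u ∈ K, 1 / 2 < ⟪u, A (barlowPos 1 (Real.sqrt (2 / 3)) constHagg 0 0 1)⟫_ℝ) ∨ ⟪A (barlowPos 1 (Real.sqrt (2 / 3)) constHagg 0 0 1), ν⟫_ℝ ≤ -t) then (1 : ℝ) else 0) +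
        1 / 2 * (if ⟪A (barlowPos 1 (Real.sqrt (2 / 3)) constHagg 0 0 1), ν⟫_ℝ = 0 ∧ (∃ u ∈ K, 1 / 2 < ⟪u, A (barlowPos 1 (Real.sqrt (2 / 3)) constHagg 0 0 1)⟫_ℝ) then (1 : ℝ) else 0)) +
      ((if ⟪-A (barlowPos 1 (Real.sqrt (2 / 3)) constHagg 0 0 1), ν⟫_ℝ < 0 ∧ ((∃ u ∈ K, 1 / 2 < ⟪u, -A (barlowPos 1 (Real.sqrt (2 / 3)) constHagg 0 0 1)⟫_ℝ) ∨ ⟪-A (barlowPos 1 (Real.sqrt (2 / 3)) constHagg 0 0 1), ν⟫_ℝ ≤ -t) then (1 : ℝ) else 0) +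
        1 / 2 * (if ⟪-A (barlowPos 1 (Real.sqrt (2 / 3)) constHagg 0 0 1), ν⟫_ℝ = 0 ∧ (∃ u ∈ K, 1 / 2 < ⟪u, -A (barlowPos 1 (Real.sqrt (2 / 3)) constHagg 0 0 1)⟫_ℝ) then (1 : ℝ) else 0)) ≤
      (if (∃ u ∈ K, 1 / 2 < ⟪u, if ⟪g₂, ν⟫_ℝ < 0 then g₂ else -g₂⟫_ℝ) ∨
          ⟪(if ⟪g₂, ν⟫_ℝ < 0 then g₂ else -g₂), ν⟫_ℝ ≤ -t then (1 : ℝ) else 0) +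
        1 / 2 * (if ⟪A (barlowPos 1 (Real.sqrt (2 / 3)) constHagg 0 0 1), ν⟫_ℝ = 0 then (1 : ℝ) else 0) := by
    rcases hg₂ with rfl | rfl
    · exact pair_hex_le _ ν K t
    · exact pair_hex_le' _ ν K t
  have P3 : ((if ⟪A (barlowPos 1 (Real.sqrt (2 / 3)) constHagg 0 1 (-1)), ν⟫_ℝ < 0 ∧ ((∃ u ∈ K, 1 / 2 < ⟪u, A (barlowPos 1 (Real.sqrt (2 / 3)) constHagg 0 1 (-1))⟫_ℝ) ∨ ⟪A (barlowPos 1 (Real.sqrt (2 / 3)) constHagg 0 1 (-1)), ν⟫_ℝ ≤ -t) then (1 : ℝ) else 0) +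
        1 / 2 * (if ⟪A (barlowPos 1 (Real.sqrt (2 / 3)) constHagg 0 1 (-1)), ν⟫_ℝ = 0 ∧ (∃ u ∈ K, 1 / 2 < ⟪u, A (barlowPos 1 (Real.sqrt (2 / 3)) constHagg 0 1 (-1))⟫_ℝ) then (1 : ℝ) else 0)) +
      ((if ⟪-A (barlowPos 1 (Real.sqrt (2 / 3)) constHagg 0 1 (-1)), ν⟫_ℝ < 0 ∧ ((∃ u ∈ K, 1 / 2 < ⟪u, -A (barlowPos 1 (Real.sqrt (2 / 3)) constHagg 0 1 (-1))⟫_ℝ) ∨ ⟪-A (barlowPos 1 (Real.sqrt (2 / 3)) constHagg 0 1 (-1)), ν⟫_ℝ ≤ -t) then (1 : ℝ) else 0) +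
        1 / 2 * (if ⟪-A (barlowPos 1 (Real.sqrt (2 / 3)) constHagg 0 1 (-1)), ν⟫_ℝ = 0 ∧ (∃ u ∈ K, 1 / 2 < ⟪u, -A (barlowPos 1 (Real.sqrt (2 / 3)) constHagg 0 1 (-1))⟫_ℝ) then (1 : ℝ) else 0)) ≤
      (if (∃ u ∈ K, 1 / 2 < ⟪u, if ⟪g₃, ν⟫_ℝ < 0 then g₃ else -g₃⟫_ℝ) ∨
          ⟪(if ⟪g₃, ν⟫_ℝ < 0 then g₃ else -g₃), ν⟫_ℝ ≤ -t then (1 : ℝ) else 0) +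
        1 / 2 * (if ⟪A (barlowPos 1 (Real.sqrt (2 / 3)) constHagg 0 1 (-1)), ν⟫_ℝ = 0 then (1 : ℝ) else 0) := by
    rcases hg₃ with rfl | rfl
    · exact pair_hex_le _ ν K t
    · exact pair_hex_le' _ ν K t
  have Q1 := pair_down_le (A (barlowPos 1 (Real.sqrt (2 / 3)) constHagg 1 0 0)) ν K t hw₁
  have Q2 := pair_down_le (A (barlowPos 1 (Real.sqrt (2 / 3)) constHagg 1 (-1) 0)) ν K t hw₂
  have Q3 := pair_level (A (barlowPos 1 (Real.sqrt (2 / 3)) constHagg 1 0 (-1))) ν K t hw₃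
  linarith only [h12, P1, P2, P3, Q1, Q2, Q3]

end Summit.Ventures.Crystal3D.Theorems

end
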